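import Mathlib
import Literature.Analysis.Complex.LogDerivativeLemma
import Literature.Analysis.Complex.NevanlinnaMultiplier
import HarnessLib

/-!
# Uniform mean growth of holomorphic maps omitting the `N`-th roots of unity (CDT §6.2)

`Literature/Analysis/Complex/OmittedValuesGrowth.lean`. Everything here is PROVED (no definition,
no named fact). We formalize §6.2 ("Proof of Theorem 6.0.1") of F. Calegari, V. Dimitrov, Y. Tang,
*The unbounded denominators conjecture* (J. Amer. Math. Soc. **38** (2025), 627–702;
arXiv:2109.09040): the Nevanlinna-theoretic mechanism by which the lemma on the logarithmic
derivative (their Lemma 6.1.2, `Literature.Analysis.Complex.circleAverage_posLog_norm_logDeriv_lt`)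
yields a *uniform second-main-theorem-type bound* for a holomorphic map `F` of the unit disc
omitting the `N`-th roots of unity, `N ≥ 2`, with `F(0) = 0`, `|F'(0)| ≥ 1` and `F'` nowhere
vanishing — their display (6.12):

  `(N − 1) T(r, F) ≪ log⁺ (N/(1 − r)) + sup_{|z| = (1+r)/2} log⁺ log |F|`,

here with explicit absolute constants (`uniform_growth_of_omitting_rootsOfUnity`):

  `(N − 1) m(r, F) ≤ 2 log(1/(1 − r)) + log N + 2 M + 15 log 2 + 2/e`

whenever `log⁺ log⁺ |F| ≤ M` on `|z| = (1 + r)/2` (`m(r, F) = ∫_{|z|=r} log⁺|F| μ_Haar = T(r, F)` for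
holomorphic `F`). Applied to the universal covering map `F_N : D(0,1) → ℂ ∖ μ_N` and combined with
the crude supremum bound of their Lemma 5.3.5 (which rests on the uniformization of `ℂ ∖ μ_N`, not
formalized here), this is CDT's Theorem 6.0.1.

The proof is theirs, step by step (numbering of the published version):

1. `circleAverage_posLog_norm_mono` — monotonicity of the mean proximity `m(r, φ)` in `r` for
   holomorphic `φ` (used in the proof of Corollary 6.2.1: "`m(r, f'/f) = T(r, f'/f)` is a monotone
   increasing function of `r`"), from the Poisson–Jensen inequality and `∫_{|z|=r} P(z, w) = 1`.
2. `cor621` (Corollary 6.2.1) — `m(r, f'/f) ≤ log N + M + log(1/(1−r)) + 6 log 2 + 1/e` for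
   `f = 1 − F^N`, from Lemma 6.1.2 at the outer radius `R = (1 + r)/2`.
3. `cor622` (Corollary 6.2.2) — `m(r, F/F') ≤ m(r, F) + M + log(1/(1−r)) + 7 log 2 + 1/e`, from
   Lemma 6.1.2 for the unit `g = 1 − F` and the first-main-theorem bookkeeping
   `m(r, F/F') = m(r, F'/F) + ∫ log|F| − log|F'(0)|` (we avoid the counting function by using the
   mean value property of `log|F'|` directly).
4. The "happy accident" (6.9): `F^N/(F^N − 1) = (F/(N F')) · (f'/f)`, so that
   `m(r, F^N/(F^N−1)) ≤ m(r, F/F') + m(r, f'/f)` (display (6.11)).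
5. The lower bound (6.7): `m(r, F^N/(F^N − 1)) ≥ N m(r, F) − log 4`.
6. Assembly (6.12).

## References

* [CalegariDimitrovTang2025] F. Calegari, V. Dimitrov, Y. Tang, The unbounded denominators
  conjecture, J. Amer. Math. Soc. 38 (2025), no. 3, 627–702, §6.2 (Corollaries 6.2.1–6.2.2,
  displays (6.7)–(6.12)); arXiv:2109.09040.
-/

noncomputable section

open Complex Metric Real Set Filter Topology MeasureTheory InnerProductSpace

namespace Literature.Analysis.Complex

/-! ### 1. The Poisson–Jensen inequality at a general radius -/

/-- Scale invariance of the Poisson kernel: `P(ρu, ρw) = P(u, w)`. [folklore] -/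
theorem poissonKernel_mul_left {ρ : ℝ} (hρ : ρ ≠ 0) (u w : ℂ) :
    poissonKernel 0 ((ρ : ℂ) * u) ((ρ : ℂ) * w) = poissonKernel 0 u w := by
  simp only [poissonKernel, sub_zero, ← mul_sub, norm_mul, Complex.norm_real, Real.norm_eq_abs,
    mul_pow]
  have h2 : (|ρ| : ℝ) ^ 2 ≠ 0 := pow_ne_zero 2 (abs_ne_zero.mpr hρ)
  rw [mul_div_mul_left _ _ h2]

/-- **Poisson–Jensen inequality at radius `ρ`**: for `f` holomorphic about `|z| ≤ ρ` without
zeros on `|z| = ρ` and `|z| < ρ`, `log|f(z)| ≤ ∫_{|w|=ρ} P(z, w) log⁺|f(w)| μ_Haar(w)` (the case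
`ρ = 1` is `log_norm_le_circleAverage_poissonKernel_mul_posLog`; rescale). [folklore] -/
theorem log_norm_le_circleAverage_poissonKernel_mul_posLog_of_radius {f : ℂ → ℂ} {ρ : ℝ}
    (hρ : 0 < ρ) (hf : AnalyticOnNhd ℂ f (closedBall 0 ρ)) (hf0 : ∀ z ∈ sphere (0 : ℂ) ρ, f z ≠ 0)
    {z : ℂ} (hz : z ∈ ball (0 : ℂ) ρ) :
    Real.log ‖f z‖ ≤ circleAverage (fun w ↦ poissonKernel 0 z w * log⁺ ‖f w‖) 0 ρ := by
  set f₁ : ℂ → ℂ := fun u ↦ f (ρ * u) with hf₁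
  have hρ0 : (ρ : ℂ) ≠ 0 := by exact_mod_cast hρ.ne'
  have hf₁an : AnalyticOnNhd ℂ f₁ (closedBall 0 1) := by
    intro u hu
    have hu1 : ‖u‖ ≤ 1 := by simpa using hu
    have hρu : (ρ : ℂ) * u ∈ closedBall (0 : ℂ) ρ := by
      simp only [mem_closedBall, dist_zero_right, norm_mul, Complex.norm_real, Real.norm_eq_abs,
        abs_of_pos hρ]
      nlinarith
    exact (hf _ hρu).comp_of_eq (analyticAt_const.mul analyticAt_id) rfl
  have hf₁0 : ∀ u ∈ sphere (0 : ℂ) 1, f₁ u ≠ 0 := by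
    intro u hu
    have hu1 : ‖u‖ = 1 := by simpa using hu
    refine hf0 _ ?_
    simp [abs_of_pos hρ, hu1]
  have hz' : ‖z‖ < ρ := by simpa using hz
  set u₀ : ℂ := (ρ : ℂ)⁻¹ * z with hu₀
  have hu₀b : u₀ ∈ ball (0 : ℂ) 1 := by
    simp only [hu₀, mem_ball, dist_zero_right, norm_mul, norm_inv, Complex.norm_real,
      Real.norm_eq_abs, abs_of_pos hρ]
    rw [inv_mul_lt_iff₀ hρ]
    simpa using hz'
  have key := log_norm_le_circleAverage_poissonKernel_mul_posLog hf₁an hf₁0 hu₀b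
  have hzu : (ρ : ℂ) * u₀ = z := by rw [hu₀, ← mul_assoc, mul_inv_cancel₀ hρ0, one_mul]
  have hlhs : f₁ u₀ = f z := by simp only [hf₁, hzu]
  rw [hlhs] at key
  refine key.trans (le_of_eq ?_)
  simp only [circleAverage_def, hf₁]
  congr 2 with θ
  have hcm : circleMap 0 ρ θ = (ρ : ℂ) * circleMap 0 1 θ := by simp [circleMap_zero]
  rw [hcm, ← hzu, poissonKernel_mul_left hρ.ne']

/-! ### 2. The mean of the Poisson kernel over an inner circle -/

/-- `∫_{|z|=r} P(z, w) μ_Haar(z) = 1` for `|w| = ρ > r ≥ 0` (`P(z,w) = (ρ² − r²)/|w − z|²` and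
`∫_{|z|=r} |w − z|⁻² = 1/(ρ² − r²)`, `circleAverage_inv_norm_sub_sq`). [folklore] -/
theorem circleAverage_poissonKernel_eq_one {w : ℂ} {r ρ : ℝ} (hr : 0 ≤ r) (hrρ : r < ρ)
    (hw : ‖w‖ = ρ) : circleAverage (fun z ↦ poissonKernel 0 z w) 0 r = 1 := by
  have hρr : 0 < ρ ^ 2 - r ^ 2 := by nlinarith
  have hsphere : ∀ z ∈ sphere (0 : ℂ) |r|,
      poissonKernel 0 z w = (ρ ^ 2 - r ^ 2) • (‖w - z‖ ^ 2)⁻¹ := by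
    intro z hz
    rw [abs_of_nonneg hr] at hz
    have hz' : ‖z‖ = r := by simpa using hz
    simp only [poissonKernel, sub_zero, hw, hz', smul_eq_mul, div_eq_mul_inv]
  rw [circleAverage_congr_sphere hsphere, circleAverage_fun_smul,
    circleAverage_inv_norm_sub_sq hr hrρ hw, smul_eq_mul, mul_inv_cancel₀ hρr.ne']

/-! ### 3. Monotonicity of the mean proximity in the radius -/

/-- The zeros of a function holomorphic about a closed disc and not identically zero there form a
finite set. [folklore] -/
theorem finite_zeros_of_analyticOnNhd {f : ℂ → ℂ} {R : ℝ} (hf : AnalyticOnNhd ℂ f (closedBall 0 R))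
    (hne : ∃ z ∈ closedBall (0 : ℂ) R, f z ≠ 0) :
    {z | z ∈ closedBall (0 : ℂ) R ∧ f z = 0}.Finite := by
  classical
  obtain ⟨z₀, hz₀, hfz₀⟩ := hne
  have hR : 0 ≤ R := by simpa using nonempty_closedBall.1 ⟨z₀, hz₀⟩
  rcases hR.eq_or_lt with hR0 | hR0
  · -- `R = 0`: the closed ball is `{0}`
    refine (Set.finite_singleton (0 : ℂ)).subset fun z hz ↦ ?_
    have : ‖z‖ ≤ 0 := by simpa [← hR0] using hz.1
    simpa using norm_le_zero_iff.mp this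
  obtain ⟨n, f₁, hf₁, hf₁0, hff₁⟩ := exists_eq_pow_mul_of_analyticOnNhd hf ⟨z₀, hz₀, hfz₀⟩
  obtain ⟨G₀, -, hG₀0, hfac⟩ := exists_eq_prod_pow_sub_mul hR0 le_rfl hf₁ hf₁0
  set S := ((MeromorphicOn.divisor f₁ (closedBall (0 : ℂ) R)).finiteSupport
    (isCompact_closedBall (0 : ℂ) R)).toFinset with hS
  refine (Set.finite_singleton (0 : ℂ)).union S.finite_toSet |>.subset fun z hz ↦ ?_
  obtain ⟨hzR, h0⟩ := hz
  rw [hff₁ z, hfac z hzR, mul_eq_zero, mul_eq_zero] at h0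
  rcases h0 with h0 | h0 | h0
  · exact Or.inl (pow_eq_zero_iff'.mp h0).1
  · right
    obtain ⟨u, hu, hu0⟩ := Finset.prod_eq_zero_iff.mp h0
    have : z = u := sub_eq_zero.mp (pow_eq_zero_iff'.mp hu0).1
    rw [this]
    exact hu
  · exact absurd h0 (hG₀0 z hzR)

/-- The mean proximity `ρ ↦ m(ρ, f) = ∫_{|z|=ρ} log⁺|f|` is continuous on `[0, R]` for `f`
holomorphic about `|z| ≤ R`. [folklore] -/
theorem continuousOn_circleAverage_posLog_norm {f : ℂ → ℂ} {R : ℝ}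
    (hf : AnalyticOnNhd ℂ f (closedBall 0 R)) :
    ContinuousOn (fun ρ ↦ circleAverage (fun w ↦ log⁺ ‖f w‖) 0 ρ) (Icc 0 R) := by
  have hfc : ContinuousOn f (closedBall (0 : ℂ) R) := fun z hz ↦ (hf z hz).continuousAt.continuousWithinAt
  refine ContinuousOn.circleAverage ?_ fun r hr ↦ hr.1
  refine ((by fun_prop : Continuous fun x : ℝ ↦ log⁺ x).comp_continuousOn
    (continuous_norm.comp_continuousOn (hfc.mono ?_)))
  intro z hz
  simp only [sub_zero, mem_setOf_eq, mem_Icc] at hz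
  simpa using hz.2

/-- Monotonicity of the mean proximity, outer circle free of zeros: for `f` holomorphic about
`|z| ≤ ρ` without zeros on `|z| = ρ` and `0 < r ≤ ρ`, `m(r, f) ≤ m(ρ, f)` (Poisson–Jensen:
`log⁺|f(z)| ≤ ∫_{|w|=ρ} P(z,w) log⁺|f(w)|`, integrate over `|z| = r` and use
`∫_{|z|=r} P(z, w) = 1`). [folklore] -/
theorem circleAverage_posLog_norm_le_of_sphere {f : ℂ → ℂ} {r ρ : ℝ} (hr : 0 < r) (hrρ : r ≤ ρ)
    (hf : AnalyticOnNhd ℂ f (closedBall 0 ρ)) (hf0 : ∀ z ∈ sphere (0 : ℂ) ρ, f z ≠ 0) :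
    circleAverage (fun z ↦ log⁺ ‖f z‖) 0 r ≤ circleAverage (fun z ↦ log⁺ ‖f z‖) 0 ρ := by
  rcases hrρ.eq_or_lt with h | hrρ'
  · rw [h]
  have hρ : 0 < ρ := hr.trans hrρ'
  have hfc : ContinuousOn f (closedBall (0 : ℂ) ρ) := fun z hz ↦ (hf z hz).continuousAt.continuousWithinAt
  have hsr : sphere (0 : ℂ) r ⊆ ball 0 ρ := sphere_subset_closedBall.trans (closedBall_subset_ball hrρ')
  -- joint continuity of the integrand on the torus `|z| = r`, `|w| = ρ`
  have hne : ∀ θ φ : ℝ, circleMap 0 ρ φ - circleMap 0 r θ ≠ 0 := by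
    intro θ φ h0
    have h1 : ‖circleMap 0 ρ φ‖ = ‖circleMap 0 r θ‖ := by rw [sub_eq_zero.mp h0]
    simp [abs_of_pos hρ, abs_of_pos hr] at h1
    linarith
  have hfφ : Continuous fun φ : ℝ ↦ f (circleMap 0 ρ φ) :=
    hfc.comp_continuous (continuous_circleMap 0 ρ)
      fun φ ↦ sphere_subset_closedBall (circleMap_mem_sphere 0 hρ.le φ)
  have hK : Continuous fun p : ℝ × ℝ ↦ poissonKernel 0 (circleMap 0 r p.1) (circleMap 0 ρ p.2) := by
    simp only [poissonKernel, sub_zero]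
    refine Continuous.div (by fun_prop) (by fun_prop) fun p ↦ ?_
    exact pow_ne_zero 2 (norm_ne_zero_iff.mpr (hne p.1 p.2))
  have hF : Continuous fun p : ℝ × ℝ ↦ poissonKernel 0 (circleMap 0 r p.1) (circleMap 0 ρ p.2) *
      log⁺ ‖f (circleMap 0 ρ p.2)‖ :=
    hK.mul ((by fun_prop : Continuous fun x : ℝ ↦ log⁺ x).comp (continuous_norm.comp (hfφ.comp continuous_snd)))
  -- pointwise Poisson–Jensen on `|z| = r`
  have hpt : ∀ z ∈ sphere (0 : ℂ) |r|, log⁺ ‖f z‖ ≤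
      circleAverage (fun w ↦ poissonKernel 0 z w * log⁺ ‖f w‖) 0 ρ := by
    intro z hz
    rw [abs_of_pos hr] at hz
    have hzb : z ∈ ball (0 : ℂ) ρ := hsr hz
    have hA0 : 0 ≤ circleAverage (fun w ↦ poissonKernel 0 z w * log⁺ ‖f w‖) 0 ρ := by
      refine circleAverage_nonneg_of_nonneg fun w hw ↦ mul_nonneg ?_ posLog_nonneg
      rw [abs_of_pos hρ] at hw
      -- scale to the unit disc to use `poissonKernel_nonneg`
      have hw' : ‖w‖ = ρ := by simpa using hw
      have hzρ : ‖z‖ < ρ := by simpa using hzb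
      have := poissonKernel_nonneg (z := (ρ : ℂ)⁻¹ * z) (w := (ρ : ℂ)⁻¹ * w)
        (by simp only [mem_ball, dist_zero_right, norm_mul, norm_inv, Complex.norm_real,
              Real.norm_eq_abs, abs_of_pos hρ]; rw [inv_mul_lt_iff₀ hρ]; simpa using hzρ)
        (by simp [abs_of_pos hρ, hw', inv_mul_cancel₀ hρ.ne'])
      rwa [← Complex.ofReal_inv, poissonKernel_mul_left (inv_ne_zero hρ.ne')] at this
    rw [posLog_apply, max_le_iff]
    exact ⟨hA0, log_norm_le_circleAverage_poissonKernel_mul_posLog_of_radius hρ hf hf0 hzb⟩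
  calc circleAverage (fun z ↦ log⁺ ‖f z‖) 0 r
      ≤ circleAverage (fun z ↦ circleAverage (fun w ↦ poissonKernel 0 z w * log⁺ ‖f w‖) 0 ρ) 0 r := by
        refine circleAverage_mono ?_ ?_ hpt
        · refine ContinuousOn.circleIntegrable hr.le ?_
          exact (by fun_prop : Continuous fun x : ℝ ↦ log⁺ x).comp_continuousOn
            (continuous_norm.comp_continuousOn (hfc.mono (hsr.trans ball_subset_closedBall)))
        · rw [CircleIntegrable]
          refine Continuous.intervalIntegrable ?_ _ _
          have : (fun θ : ℝ ↦ circleAverage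
              (fun w ↦ poissonKernel 0 (circleMap 0 r θ) w * log⁺ ‖f w‖) 0 ρ) =
              fun θ ↦ (2 * π)⁻¹ • ∫ φ in (0 : ℝ)..2 * π, poissonKernel 0 (circleMap 0 r θ)
                (circleMap 0 ρ φ) * log⁺ ‖f (circleMap 0 ρ φ)‖ := by
            funext θ; rfl
          rw [this]
          exact (continuous_const_smul _).comp
            (intervalIntegral.continuous_parametric_intervalIntegral_of_continuous'
              (f := fun θ φ ↦ poissonKernel 0 (circleMap 0 r θ) (circleMap 0 ρ φ) *
                log⁺ ‖f (circleMap 0 ρ φ)‖) hF 0 (2 * π))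
    _ = circleAverage (fun w ↦ circleAverage (fun z ↦ poissonKernel 0 z w * log⁺ ‖f w‖) 0 r) 0 ρ :=
        circleAverage_circleAverage_swap (F := fun z w ↦ poissonKernel 0 z w * log⁺ ‖f w‖) hF
    _ = circleAverage (fun w ↦ log⁺ ‖f w‖) 0 ρ := by
        apply circleAverage_congr_sphere
        intro w hw
        rw [abs_of_pos hρ] at hw
        have hw' : ‖w‖ = ρ := by simpa using hw
        have hrw : (fun z ↦ poissonKernel 0 z w * log⁺ ‖f w‖) =
            fun z ↦ (log⁺ ‖f w‖) • poissonKernel 0 z w := by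
          funext z; simp only [smul_eq_mul]; ring
        beta_reduce
        rw [hrw, circleAverage_fun_smul, circleAverage_poissonKernel_eq_one hr.le hrρ' hw', smul_eq_mul,
          mul_one]

/-- **Monotonicity of the mean proximity in the radius.** For `f` holomorphic about the closed
disc `|z| ≤ ρ` and `0 < r ≤ ρ`: `m(r, f) ≤ m(ρ, f)`, `m(t, f) = ∫_{|z|=t} log⁺|f| μ_Haar` —
"`m(r, ·) = T(r, ·)` is a monotone increasing function of `r`" for holomorphic functions, the fact
invoked in the proof of CDT Corollary 6.2.1 (cf. Bombieri–Gubler, Corollary 13.2.14). Zeros on the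
outer circle are handled by the continuity of `m(·, f)` and the finiteness of the zero set.
[folklore] -/
theorem circleAverage_posLog_norm_mono {f : ℂ → ℂ} {r ρ : ℝ} (hr : 0 < r) (hrρ : r ≤ ρ)
    (hf : AnalyticOnNhd ℂ f (closedBall 0 ρ)) :
    circleAverage (fun z ↦ log⁺ ‖f z‖) 0 r ≤ circleAverage (fun z ↦ log⁺ ‖f z‖) 0 ρ := by
  classical
  rcases hrρ.eq_or_lt with h | hrρ'
  · rw [h]
  have hρ : 0 < ρ := hr.trans hrρ'
  set m : ℝ → ℝ := fun t ↦ circleAverage (fun z ↦ log⁺ ‖f z‖) 0 t with hm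
  -- the trivial case `f ≡ 0` on the closed disc
  by_cases htriv : ∀ z ∈ closedBall (0 : ℂ) ρ, f z = 0
  · have hzero : ∀ t ∈ Icc 0 ρ, m t = 0 := by
      intro t ht
      simp only [hm]
      rw [show (0 : ℝ) = circleAverage (fun _ ↦ (0 : ℝ)) 0 t by simp [circleAverage_const]]
      apply circleAverage_congr_sphere
      intro z hz
      rw [abs_of_nonneg ht.1] at hz
      have : z ∈ closedBall (0 : ℂ) ρ := sphere_subset_closedBall.trans (closedBall_subset_closedBall ht.2) hz
      simp [htriv z this]
    show m r ≤ m ρ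
    rw [hzero r ⟨hr.le, hrρ⟩, hzero ρ ⟨hρ.le, le_rfl⟩]
  push Not at htriv
  -- the zero set is finite, hence so is the set of "bad radii"
  have hfin := finite_zeros_of_analyticOnNhd hf htriv
  set B : Finset ℝ := hfin.toFinset.image fun z ↦ ‖z‖ with hB
  have hgood : ∀ t, 0 < t → t ≤ ρ → t ∉ B → ∀ z ∈ sphere (0 : ℂ) t, f z ≠ 0 := by
    intro t ht htρ htB z hz h0
    have hz' : ‖z‖ = t := by simpa using hz
    apply htB
    rw [hB, Finset.mem_image]
    refine ⟨z, ?_, hz'⟩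
    rw [Finite.mem_toFinset]
    exact ⟨by simpa using (hz'.le.trans htρ), h0⟩
  -- continuity of `m` at `ρ`
  have hmc := continuousOn_circleAverage_posLog_norm hf
  show m r ≤ m ρ
  by_contra hlt
  push Not at hlt
  set ε := (m r - m ρ) / 2 with hε
  have hεpos : 0 < ε := by rw [hε]; linarith
  obtain ⟨δ, hδ, hδε⟩ := (Metric.continuousOn_iff.mp hmc) ρ ⟨hρ.le, le_rfl⟩ ε hεpos
  have hlo : max r (ρ - δ) < ρ := max_lt hrρ' (by linarith)
  obtain ⟨t, ht, htB⟩ := (Set.Ioo_infinite hlo).exists_notMem_finset B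
  obtain ⟨ht1, ht2⟩ := ht
  have htr : r < t := lt_of_le_of_lt (le_max_left _ _) ht1
  have htδ : ρ - δ < t := lt_of_le_of_lt (le_max_right _ _) ht1
  have ht0 : 0 < t := hr.trans htr
  -- monotonicity up to the good radius `t`, then continuity from `t` to `ρ`
  have h1 : m r ≤ m t := circleAverage_posLog_norm_le_of_sphere hr htr.le
    (hf.mono (closedBall_subset_closedBall ht2.le)) (hgood t ht0 ht2.le htB)
  have h2 := hδε t ⟨ht0.le, ht2.le⟩
    (by rw [dist_eq_norm, Real.norm_eq_abs, abs_lt]; constructor <;> linarith)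
  rw [dist_eq_norm, Real.norm_eq_abs, abs_lt] at h2
  have : m t < m ρ + ε := by linarith [h2.2]
  linarith

/-! ### 4. Bookkeeping with mean proximities `m(r, φ) = ∫_{|z|=r} log⁺|φ| μ_Haar` -/

/-- `m(r, φᴺ) = N m(r, φ)`. [folklore] -/
theorem circleAverage_posLog_norm_pow (φ : ℂ → ℂ) (N : ℕ) (r : ℝ) :
    circleAverage (fun z ↦ log⁺ ‖φ z ^ N‖) 0 r = N * circleAverage (fun z ↦ log⁺ ‖φ z‖) 0 r := by
  have : (fun z ↦ log⁺ ‖φ z ^ N‖) = fun z ↦ (N : ℝ) • log⁺ ‖φ z‖ := by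
    funext z
    rw [norm_pow, posLog_pow, smul_eq_mul]
  rw [this, circleAverage_fun_smul, smul_eq_mul]

/-- `m(r, 1/φ) = m(r, φ) − ∫_{|z|=r} log|φ|` (the first main theorem without its counting
functions: `log⁺(1/x) = log⁺ x − log x`), for `φ` meromorphic on the circle. [folklore] -/
theorem circleAverage_posLog_norm_inv {φ : ℂ → ℂ} {r : ℝ} (hφ : MeromorphicOn φ (sphere (0 : ℂ) |r|)) :
    circleAverage (fun z ↦ log⁺ ‖(φ z)⁻¹‖) 0 r =
      circleAverage (fun z ↦ log⁺ ‖φ z‖) 0 r - circleAverage (fun z ↦ Real.log ‖φ z‖) 0 r := by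
  have hpt : (fun z ↦ log⁺ ‖(φ z)⁻¹‖) = (fun z ↦ log⁺ ‖φ z‖) - fun z ↦ Real.log ‖φ z‖ := by
    funext z
    simp only [Pi.sub_apply, norm_inv]
    linarith [posLog_sub_posLog_inv (x := ‖φ z‖)]
  rw [hpt, circleAverage_sub hφ.circleIntegrable_posLog_norm hφ.circleIntegrable_log_norm]

/-- Transfer of a pointwise bound `log⁺|χ| ≤ log⁺|φ| + c` on the circle to mean proximities:
`m(r, χ) ≤ m(r, φ) + c`. [folklore] -/
theorem circleAverage_posLog_norm_le_add_const {χ φ : ℂ → ℂ} {r c : ℝ}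
    (hχ : MeromorphicOn χ (sphere (0 : ℂ) |r|)) (hφ : MeromorphicOn φ (sphere (0 : ℂ) |r|))
    (h : ∀ z ∈ sphere (0 : ℂ) |r|, log⁺ ‖χ z‖ ≤ log⁺ ‖φ z‖ + c) :
    circleAverage (fun z ↦ log⁺ ‖χ z‖) 0 r ≤ circleAverage (fun z ↦ log⁺ ‖φ z‖) 0 r + c := by
  have hi : CircleIntegrable (fun z ↦ log⁺ ‖φ z‖ + c) 0 r :=
    hφ.circleIntegrable_posLog_norm.add (circleIntegrable_const c 0 r)
  calc circleAverage (fun z ↦ log⁺ ‖χ z‖) 0 r ≤ circleAverage (fun z ↦ log⁺ ‖φ z‖ + c) 0 r :=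
        circleAverage_mono hχ.circleIntegrable_posLog_norm hi h
    _ = circleAverage (fun z ↦ log⁺ ‖φ z‖) 0 r + c := by
        rw [show (fun z ↦ log⁺ ‖φ z‖ + c) = (fun z ↦ log⁺ ‖φ z‖) + fun _ ↦ c from rfl,
          circleAverage_add hφ.circleIntegrable_posLog_norm (circleIntegrable_const c 0 r),
          circleAverage_const]

/-- Transfer of a pointwise bound `log⁺|χ| ≤ log⁺|φ| + log⁺|ψ| + c` on the circle:
`m(r, χ) ≤ m(r, φ) + m(r, ψ) + c`. [folklore] -/
theorem circleAverage_posLog_norm_le_add_add_const {χ φ ψ : ℂ → ℂ} {r c : ℝ}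
    (hχ : MeromorphicOn χ (sphere (0 : ℂ) |r|)) (hφ : MeromorphicOn φ (sphere (0 : ℂ) |r|))
    (hψ : MeromorphicOn ψ (sphere (0 : ℂ) |r|))
    (h : ∀ z ∈ sphere (0 : ℂ) |r|, log⁺ ‖χ z‖ ≤ log⁺ ‖φ z‖ + log⁺ ‖ψ z‖ + c) :
    circleAverage (fun z ↦ log⁺ ‖χ z‖) 0 r ≤
      circleAverage (fun z ↦ log⁺ ‖φ z‖) 0 r + circleAverage (fun z ↦ log⁺ ‖ψ z‖) 0 r + c := by
  have h1 := hφ.circleIntegrable_posLog_norm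
  have h2 := hψ.circleIntegrable_posLog_norm
  have hi : CircleIntegrable (fun z ↦ log⁺ ‖φ z‖ + log⁺ ‖ψ z‖ + c) 0 r :=
    (h1.add h2).add (circleIntegrable_const c 0 r)
  calc circleAverage (fun z ↦ log⁺ ‖χ z‖) 0 r
      ≤ circleAverage (fun z ↦ log⁺ ‖φ z‖ + log⁺ ‖ψ z‖ + c) 0 r :=
        circleAverage_mono hχ.circleIntegrable_posLog_norm hi h
    _ = circleAverage (fun z ↦ log⁺ ‖φ z‖) 0 r + circleAverage (fun z ↦ log⁺ ‖ψ z‖) 0 r + c := by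
        rw [show (fun z ↦ log⁺ ‖φ z‖ + log⁺ ‖ψ z‖ + c) =
            ((fun z ↦ log⁺ ‖φ z‖) + fun z ↦ log⁺ ‖ψ z‖) + fun _ ↦ c from rfl,
          circleAverage_add (h1.add h2) (circleIntegrable_const c 0 r), circleAverage_add h1 h2,
          circleAverage_const]

/-- `log⁺(log⁺ x) ≤ M` implies `log⁺ x ≤ e^M`. [folklore] -/
theorem posLog_le_exp_of_posLog_posLog_le {x M : ℝ} (h : log⁺ (log⁺ x) ≤ M) : log⁺ x ≤ Real.exp M := by
  have hM : 0 ≤ M := posLog_nonneg.trans h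
  by_cases h1 : log⁺ x ≤ 1
  · have : (1 : ℝ) ≤ Real.exp M := by simpa using Real.exp_le_exp.mpr hM
    exact h1.trans this
  · push Not at h1
    rw [posLog_eq_log (by rw [abs_of_nonneg posLog_nonneg]; exact h1.le)] at h
    exact (Real.log_le_iff_le_exp (lt_trans zero_lt_one h1)).mp h

/-- `log⁺ (log 2) = 0` (as `log 2 ≤ 1`). [folklore] -/
theorem posLog_log_two : log⁺ (Real.log 2) = 0 := by
  rw [posLog_eq_zero_iff, abs_of_nonneg (Real.log_nonneg one_le_two)]
  have := Real.log_le_sub_one_of_pos (zero_lt_two)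
  linarith

/-! ### 5. Corollary 6.2.1 -/

/-- **CDT Corollary 6.2.1**, with explicit constants: let `F` be holomorphic on the open unit disc
with `F(0) = 0` and `F^N ≠ 1` there (`N ≥ 1`), let `0 < r < 1` and suppose
`log⁺ log⁺ |F| ≤ M` on the circle `|z| = (1 + r)/2`. Then for the functional unit `f = 1 − F^N`,
`m(r, f'/f) ≤ log N + M + log(1/(1 − r)) + 6 log 2 + 1/e`.
Proof (CDT): Lemma 6.1.2 between the radii `max(r, 1/4)` (monotonicity of `m(·, f'/f)`) and
`R = (1 + r)/2`, then `m(R, f) ≤ m(R, F^N) + log 2 = N m(R, F) + log 2 ≤ N e^M + log 2`.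
[cite: CalegariDimitrovTang2025, Corollary 6.2.1] -/
theorem cor621 {F : ℂ → ℂ} {N : ℕ} (hN : 1 ≤ N) {r : ℝ} (hr : 0 < r) (hr1 : r < 1)
    (hF : DifferentiableOn ℂ F (ball 0 1)) (hF0 : F 0 = 0)
    (hFN : ∀ z ∈ ball (0 : ℂ) 1, F z ^ N ≠ 1) {M : ℝ}
    (hM : ∀ z : ℂ, ‖z‖ = (1 + r) / 2 → log⁺ (log⁺ ‖F z‖) ≤ M) :
    circleAverage (fun z ↦ log⁺ ‖deriv (fun w ↦ 1 - F w ^ N) z / (1 - F z ^ N)‖) 0 r ≤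
      Real.log N + M + Real.log (1 / (1 - r)) + 6 * Real.log 2 + Real.exp (-1) := by
  set R := (1 + r) / 2 with hRdef
  have hrR : r < R := by rw [hRdef]; linarith
  have hR1 : R < 1 := by rw [hRdef]; linarith
  have hR0 : 0 < R := hr.trans hrR
  have hRle1 : R ≤ 1 := hR1.le
  have hbR : closedBall (0 : ℂ) R ⊆ ball 0 1 := closedBall_subset_ball hR1
  have hFan : ∀ z ∈ ball (0 : ℂ) 1, AnalyticAt ℂ F z := fun z hz ↦
    hF.analyticAt (isOpen_ball.mem_nhds hz)
  set f : ℂ → ℂ := fun w ↦ 1 - F w ^ N with hf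
  have hfan : ∀ z ∈ ball (0 : ℂ) 1, AnalyticAt ℂ f z := fun z hz ↦
    analyticAt_const.sub ((hFan z hz).pow N)
  have hfne : ∀ z ∈ ball (0 : ℂ) 1, f z ≠ 0 := fun z hz ↦ by
    simp only [hf]
    exact sub_ne_zero.mpr (hFN z hz).symm
  have hf1 : f 0 = 1 := by simp [hf, hF0, zero_pow (Nat.one_le_iff_ne_zero.mp hN)]
  have hfR : AnalyticOnNhd ℂ f (closedBall 0 R) := fun z hz ↦ hfan z (hbR hz)
  have hf0R : ∀ z ∈ closedBall (0 : ℂ) R, f z ≠ 0 := fun z hz ↦ hfne z (hbR hz)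
  have hld : AnalyticOnNhd ℂ (fun z ↦ deriv f z / f z) (closedBall 0 R) := fun z hz ↦
    (hfR z hz).deriv.div (hfR z hz) (hf0R z hz)
  -- Step 1: monotonicity up to `r₁ = max r (1/4)`
  set r₁ := max r (1 / 4) with hr₁
  have hr₁r : r ≤ r₁ := le_max_left _ _
  have hr₁4 : 1 / 4 ≤ r₁ := le_max_right _ _
  have hr₁0 : 0 < r₁ := hr.trans_le hr₁r
  have hr₁R : r₁ < R := max_lt hrR (by rw [hRdef]; linarith)
  have hRr₁ : (1 - r) / 4 ≤ R - r₁ := by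
    rcases le_or_gt (1 / 4 : ℝ) r with h | h
    · rw [hr₁, max_eq_left h, hRdef]; linarith
    · rw [hr₁, max_eq_right h.le, hRdef]; linarith
  have hmono := circleAverage_posLog_norm_mono hr hr₁r
    (hld.mono (closedBall_subset_closedBall hr₁R.le))
  -- Step 2: Lemma 6.1.2 between `r₁` and `R`
  have h612 := circleAverage_posLog_norm_logDeriv_lt hr₁0 hr₁R hfR hf0R hf1
  -- Step 3: `m(R, f) ≤ N e^M + log 2`
  set mR := circleAverage (fun z ↦ log⁺ ‖f z‖) 0 R with hmR
  have hMnn : 0 ≤ M :=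
    posLog_nonneg.trans (hM (R : ℂ) (by rw [Complex.norm_real, Real.norm_eq_abs, abs_of_pos hR0]))
  have hmF : circleAverage (fun z ↦ log⁺ ‖F z‖) 0 R ≤ Real.exp M := by
    refine circleAverage_mono_on_of_le_circle ?_ fun z hz ↦ ?_
    · exact (MeromorphicOn.circleIntegrable_posLog_norm fun z hz ↦
        (hFan z (hbR (sphere_subset_closedBall (by simpa [abs_of_pos hR0] using hz)))).meromorphicAt)
    · rw [abs_of_pos hR0] at hz
      exact posLog_le_exp_of_posLog_posLog_le (hM z (by simpa using hz))
  have hmR_le : mR ≤ N * Real.exp M + Real.log 2 := by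
    have h1 : mR ≤ circleAverage (fun z ↦ log⁺ ‖F z ^ N‖) 0 R + Real.log 2 := by
      refine circleAverage_posLog_norm_le_add_const (fun z hz ↦ ?_) (fun z hz ↦ ?_) fun z hz ↦ ?_
      · exact (hfR z (sphere_subset_closedBall (by simpa [abs_of_pos hR0] using hz))).meromorphicAt
      · exact ((hFan z (hbR (sphere_subset_closedBall
          (by simpa [abs_of_pos hR0] using hz)))).pow N).meromorphicAt
      · have := posLog_norm_add_le (1 : ℂ) (-(F z ^ N))
        simpa [hf, sub_eq_add_neg, norm_neg] using this
    rw [circleAverage_posLog_norm_pow] at h1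
    have h2 : (N : ℝ) * circleAverage (fun z ↦ log⁺ ‖F z‖) 0 R ≤ N * Real.exp M :=
      mul_le_mul_of_nonneg_left hmF (Nat.cast_nonneg N)
    linarith
  have hmR0 : 0 ≤ mR := circleAverage_nonneg_of_nonneg fun _ _ ↦ posLog_nonneg
  -- Step 4: the argument of `log⁺` in Lemma 6.1.2
  have hX : mR / r₁ * (R / (R - r₁)) ≤ mR * (16 / (1 - r)) := by
    have h1r : 0 < 1 - r := by linarith
    have hden : 0 < R - r₁ := by linarith
    have hA : 1 / r₁ ≤ 4 := by rw [div_le_iff₀ hr₁0]; linarith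
    have hB : R / (R - r₁) ≤ 4 / (1 - r) := by
      rw [div_le_div_iff₀ hden h1r]
      nlinarith
    calc mR / r₁ * (R / (R - r₁)) = mR * (1 / r₁) * (R / (R - r₁)) := by ring
      _ ≤ mR * 4 * (4 / (1 - r)) := by gcongr
      _ = mR * (16 / (1 - r)) := by ring
  have h1r : 0 < 1 - r := by linarith
  have hlogX : log⁺ (mR / r₁ * (R / (R - r₁))) ≤
      log⁺ mR + (4 * Real.log 2 + Real.log (1 / (1 - r))) := by
    have h16 : log⁺ (16 / (1 - r)) = 4 * Real.log 2 + Real.log (1 / (1 - r)) := by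
      have hge : (1 : ℝ) ≤ 16 / (1 - r) := by rw [le_div_iff₀ h1r]; linarith
      rw [posLog_eq_log (by rwa [abs_of_pos (by positivity)]), Real.log_div (by norm_num) h1r.ne',
        one_div, Real.log_inv, show (16 : ℝ) = 2 ^ 4 by norm_num, Real.log_pow]
      push_cast
      ring
    calc log⁺ (mR / r₁ * (R / (R - r₁)))
        ≤ log⁺ (mR * (16 / (1 - r))) := posLog_le_posLog (by positivity) hX
      _ ≤ log⁺ mR + log⁺ (16 / (1 - r)) := posLog_mul
      _ = _ := by rw [h16]
  have hlogmR : log⁺ mR ≤ Real.log 2 + Real.log N + M := by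
    calc log⁺ mR ≤ log⁺ (N * Real.exp M + Real.log 2) := posLog_le_posLog hmR0 hmR_le
      _ ≤ Real.log 2 + log⁺ (N * Real.exp M) + log⁺ (Real.log 2) := posLog_add
      _ ≤ Real.log 2 + (log⁺ (N : ℝ) + log⁺ (Real.exp M)) + 0 := by
          rw [posLog_log_two]
          gcongr
          exact posLog_mul
      _ = Real.log 2 + Real.log N + M := by
          rw [log_of_nat_eq_posLog, posLog_eq_log (by rw [abs_of_pos (Real.exp_pos M)]; simpa using hMnn),
            Real.log_exp]
          ring
  -- assembly
  change circleAverage (fun z ↦ log⁺ ‖deriv f z / f z‖) 0 r ≤ _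
  have hlog2 : Real.log 16 = 4 * Real.log 2 := by
    rw [show (16 : ℝ) = 2 ^ 4 by norm_num, Real.log_pow]; push_cast; ring
  linarith [hmono, h612, hlogX, hlogmR]

/-! ### 6. Corollary 6.2.2 -/

/-- **CDT Corollary 6.2.2**, with explicit constants: let `F` be holomorphic on the open unit disc
with `F(0) = 0`, `|F'(0)| ≥ 1`, `F'` nowhere vanishing and `F ≠ 1` there, let `0 < r < 1` and
suppose `log⁺ log⁺ |F| ≤ M` on `|z| = (1 + r)/2`. Then
`m(r, F/F') ≤ m(r, F) + M + log(1/(1 − r)) + 7 log 2 + 1/e`.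
Proof (CDT): `m(r, F/F') = m(r, F'/F) + N(r, 1/F)` (first main theorem) — here in the form
`m(r, F/F') = m(r, F'/F) + ∫_{|z|=r} log|F| − log|F'(0)|` (mean value property of `log|F'|`) —
then `m(r, F'/F) ≤ m(r, (1−F)'/(1−F)) + m(r, 1/F) + log 2`, `m(r, 1/F) + ∫ log|F| = m(r, F)`,
`|F'(0)| ≥ 1`, and Lemma 6.1.2 for the unit `1 − F` (Corollary 6.2.1 with `N = 1`).
[cite: CalegariDimitrovTang2025, Corollary 6.2.2] -/
theorem cor622 {F : ℂ → ℂ} {r : ℝ} (hr : 0 < r) (hr1 : r < 1)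
    (hF : DifferentiableOn ℂ F (ball 0 1)) (hF0 : F 0 = 0) (hF'0 : 1 ≤ ‖deriv F 0‖)
    (hF' : ∀ z ∈ ball (0 : ℂ) 1, deriv F z ≠ 0) (hF1 : ∀ z ∈ ball (0 : ℂ) 1, F z ≠ 1) {M : ℝ}
    (hM : ∀ z : ℂ, ‖z‖ = (1 + r) / 2 → log⁺ (log⁺ ‖F z‖) ≤ M) :
    circleAverage (fun z ↦ log⁺ ‖F z / deriv F z‖) 0 r ≤
      circleAverage (fun z ↦ log⁺ ‖F z‖) 0 r + M + Real.log (1 / (1 - r)) + 7 * Real.log 2 +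
        Real.exp (-1) := by
  have hFan : ∀ z ∈ ball (0 : ℂ) 1, AnalyticAt ℂ F z := fun z hz ↦
    hF.analyticAt (isOpen_ball.mem_nhds hz)
  have hbr : closedBall (0 : ℂ) r ⊆ ball 0 1 := closedBall_subset_ball hr1
  have hsr : sphere (0 : ℂ) |r| ⊆ ball 0 1 := by
    rw [abs_of_pos hr]; exact sphere_subset_closedBall.trans hbr
  -- Corollary 6.2.1 with `N = 1` for the unit `g = 1 − F`
  have h621 := cor621 le_rfl hr hr1 hF hF0 (N := 1) (fun z hz ↦ by simpa using hF1 z hz) hM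
  simp only [Nat.cast_one, Real.log_one, zero_add, pow_one] at h621
  -- `|g'/g| = |F'/(1 − F)|`
  have hg' : ∀ z ∈ ball (0 : ℂ) 1, deriv (fun w ↦ 1 - F w) z = -deriv F z := by
    intro z hz
    rw [deriv_const_sub]
  have h621' : circleAverage (fun z ↦ log⁺ ‖deriv F z / (1 - F z)‖) 0 r ≤
      M + Real.log (1 / (1 - r)) + 6 * Real.log 2 + Real.exp (-1) := by
    refine le_trans (le_of_eq ?_) h621
    apply circleAverage_congr_sphere
    intro z hz
    simp only [hg' z (hsr hz), neg_div, norm_neg]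
  -- meromorphy on the circle `|z| = r`
  have hmF : MeromorphicOn F (sphere (0 : ℂ) |r|) := fun z hz ↦ (hFan z (hsr hz)).meromorphicAt
  have hmF' : MeromorphicOn (deriv F) (sphere (0 : ℂ) |r|) := fun z hz ↦ (hFan z (hsr hz)).deriv.meromorphicAt
  have hm1 : MeromorphicOn (fun z ↦ F z / deriv F z) (sphere (0 : ℂ) |r|) := fun z hz ↦
    (hFan z (hsr hz)).meromorphicAt.div (hFan z (hsr hz)).deriv.meromorphicAt
  have hm2 : MeromorphicOn (fun z ↦ deriv F z / F z) (sphere (0 : ℂ) |r|) := fun z hz ↦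
    (hFan z (hsr hz)).deriv.meromorphicAt.div (hFan z (hsr hz)).meromorphicAt
  have hm3 : MeromorphicOn (fun z ↦ deriv F z / (1 - F z)) (sphere (0 : ℂ) |r|) := fun z hz ↦
    (hFan z (hsr hz)).deriv.meromorphicAt.div (analyticAt_const.sub (hFan z (hsr hz))).meromorphicAt
  have hm4 : MeromorphicOn (fun z ↦ (F z)⁻¹) (sphere (0 : ℂ) |r|) := fun z hz ↦
    (hFan z (hsr hz)).meromorphicAt.inv
  -- (B3) `m(r, F'/F) ≤ m(r, F'/(1−F)) + m(r, 1/F) + log 2`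
  have hB3 : circleAverage (fun z ↦ log⁺ ‖deriv F z / F z‖) 0 r ≤
      circleAverage (fun z ↦ log⁺ ‖deriv F z / (1 - F z)‖) 0 r +
        circleAverage (fun z ↦ log⁺ ‖(F z)⁻¹‖) 0 r + Real.log 2 := by
    refine circleAverage_posLog_norm_le_add_add_const hm2 hm3 hm4 fun z hz ↦ ?_
    have hz1 : F z ≠ 1 := hF1 z (hsr hz)
    by_cases hFz : F z = 0
    · have h0 : log⁺ ‖deriv F z / F z‖ = 0 := by
        rw [hFz, div_zero, norm_zero]
        simp [posLog_apply]
      rw [h0]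
      exact add_nonneg (add_nonneg posLog_nonneg posLog_nonneg) (Real.log_nonneg one_le_two)
    · have h1F : 1 - F z ≠ 0 := sub_ne_zero.mpr (Ne.symm hz1)
      have hid : deriv F z / F z = (deriv F z / (1 - F z)) * ((F z)⁻¹ - 1) := by
        have : (F z)⁻¹ - 1 = (1 - F z) / F z := by
          field_simp
        rw [this, div_mul_div_comm, mul_comm (1 - F z) (F z), mul_div_mul_right _ _ h1F]
      rw [hid, norm_mul]
      calc log⁺ (‖deriv F z / (1 - F z)‖ * ‖(F z)⁻¹ - 1‖)
          ≤ log⁺ ‖deriv F z / (1 - F z)‖ + log⁺ ‖(F z)⁻¹ - 1‖ := posLog_mul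
        _ ≤ log⁺ ‖deriv F z / (1 - F z)‖ + (log⁺ ‖(F z)⁻¹‖ + log⁺ ‖(-1 : ℂ)‖ + Real.log 2) := by
            gcongr
            simpa [sub_eq_add_neg] using posLog_norm_add_le ((F z)⁻¹) (-1 : ℂ)
        _ = log⁺ ‖deriv F z / (1 - F z)‖ + log⁺ ‖(F z)⁻¹‖ + Real.log 2 := by
            simp [posLog_apply]
            ring
  -- (B1) `∫ log|F| = m(r, F) − m(r, 1/F)`
  have hB1 := circleAverage_posLog_norm_inv hmF
  -- (B2) `∫ log|F'| = log|F'(0)| ≥ 0`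
  have hB2 : circleAverage (fun z ↦ Real.log ‖deriv F z‖) 0 r = Real.log ‖deriv F 0‖ := by
    have h := AnalyticOnNhd.circleAverage_log_norm_of_ne_zero (c := 0) (R := r) (g := deriv F)
      (fun z hz ↦ (hFan z (hbr (by simpa [abs_of_pos hr] using hz))).deriv)
      (fun z hz ↦ hF' z (hbr (by simpa [abs_of_pos hr] using hz)))
    simpa using h
  have hB2' : 0 ≤ circleAverage (fun z ↦ Real.log ‖deriv F z‖) 0 r := by
    rw [hB2]; exact Real.log_nonneg hF'0
  -- (B0) `m(r, F/F') − m(r, F'/F) = ∫ log|F| − ∫ log|F'|` (pointwise off the zeros of `F`)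
  have hB0 : circleAverage (fun z ↦ log⁺ ‖F z / deriv F z‖) 0 r -
      circleAverage (fun z ↦ log⁺ ‖deriv F z / F z‖) 0 r =
      circleAverage (fun z ↦ Real.log ‖F z‖) 0 r - circleAverage (fun z ↦ Real.log ‖deriv F z‖) 0 r := by
    rw [← circleAverage_sub hm1.circleIntegrable_posLog_norm hm2.circleIntegrable_posLog_norm,
      ← circleAverage_sub hmF.circleIntegrable_log_norm hmF'.circleIntegrable_log_norm]
    apply circleAverage_congr_codiscreteWithin _ hr.ne'
    -- the zeros of `F` on the circle are codiscrete (`F ≢ 0` as `F'(0) ≠ 0`)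
    have hFr : AnalyticOnNhd ℂ F (closedBall 0 |r|) := fun z hz ↦
      hFan z (hbr (by simpa [abs_of_pos hr] using hz))
    have hne : ∃ x ∈ closedBall (0 : ℂ) |r|, F x ≠ 0 := by
      by_contra hall
      push Not at hall
      have hloc : F =ᶠ[𝓝 0] fun _ ↦ (0 : ℂ) := by
        filter_upwards [closedBall_mem_nhds (0 : ℂ) (abs_pos.mpr hr.ne')] with z hz using hall z hz
      have : deriv F 0 = 0 := by rw [hloc.deriv_eq]; simp
      exact absurd this (hF' 0 (mem_ball_self one_pos))
    obtain ⟨x, hx, hFx⟩ := hne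
    have hcod : F ⁻¹' {0}ᶜ ∈ codiscreteWithin (sphere (0 : ℂ) |r|) :=
      Filter.codiscreteWithin_mono (U := closedBall (0 : ℂ) |r|) sphere_subset_closedBall
        (hFr.preimage_zero_mem_codiscreteWithin hFx hx ((convex_closedBall (0 : ℂ) |r|).isConnected ⟨x, hx⟩))
    filter_upwards [hcod, self_mem_codiscreteWithin (sphere (0 : ℂ) |r|)] with z hz hzs
    have hFz : F z ≠ 0 := hz
    have hF'z : deriv F z ≠ 0 := hF' z (hsr hzs)
    simp only [Pi.sub_apply]
    have hx : ‖deriv F z / F z‖ = ‖F z / deriv F z‖⁻¹ := by rw [norm_div, norm_div, inv_div]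
    rw [hx, posLog_sub_posLog_inv, norm_div,
      Real.log_div (norm_ne_zero_iff.mpr hFz) (norm_ne_zero_iff.mpr hF'z)]
  -- assembly
  linarith [hB0, hB1, hB2', hB3, h621']

/-! ### 7. The uniform bound (CDT (6.12)) -/

/-- **Uniform growth of holomorphic maps omitting the `N`-th roots of unity** (CDT §6.2,
display (6.12), with explicit constants — Theorem 6.0.1 modulo the crude supremum bound of
Lemma 5.3.5). Let `N ≥ 2` and let `F` be holomorphic on the open unit disc with `F(0) = 0`,
`|F'(0)| ≥ 1`, `F'` nowhere vanishing, and `F(z)^N ≠ 1` for all `|z| < 1` (so `F` omits `μ_N`).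
Let `0 < r < 1` and suppose `log⁺ log⁺ |F(z)| ≤ M` for `|z| = (1 + r)/2`. Then

  `(N − 1) · ∫_{|z|=r} log⁺|F| μ_Haar ≤ 2 log(1/(1 − r)) + log N + 2M + 15 log 2 + 2/e`.

Proof (CDT §6.2): with `f = 1 − F^N` and `p(x) = x^N/(x^N − 1)`, the identity (6.9)
`p ∘ F = (F/(N F')) · (f'/f)` gives `m(r, p ∘ F) ≤ m(r, F/F') + m(r, f'/f)` (6.11), bounded by
Corollaries 6.2.1–6.2.2; against this, `p ∘ F = 1 + 1/(F^N − 1)` gives the lower bound (6.7)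
`m(r, p ∘ F) ≥ m(r, 1/(F^N−1)) − log 2 = m(r, F^N − 1) − log 2 ≥ N m(r, F) − log 4`.
[cite: CalegariDimitrovTang2025, §6.2, (6.12)] -/
theorem uniform_growth_of_omitting_rootsOfUnity {F : ℂ → ℂ} {N : ℕ} (hN : 2 ≤ N) {r : ℝ}
    (hr : 0 < r) (hr1 : r < 1) (hF : DifferentiableOn ℂ F (ball 0 1)) (hF0 : F 0 = 0)
    (hF'0 : 1 ≤ ‖deriv F 0‖) (hF' : ∀ z ∈ ball (0 : ℂ) 1, deriv F z ≠ 0)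
    (hFN : ∀ z ∈ ball (0 : ℂ) 1, F z ^ N ≠ 1) {M : ℝ}
    (hM : ∀ z : ℂ, ‖z‖ = (1 + r) / 2 → log⁺ (log⁺ ‖F z‖) ≤ M) :
    (N - 1 : ℝ) * circleAverage (fun z ↦ log⁺ ‖F z‖) 0 r ≤
      2 * Real.log (1 / (1 - r)) + Real.log N + 2 * M + 15 * Real.log 2 + 2 * Real.exp (-1) := by
  have hN1 : 1 ≤ N := le_trans (by norm_num) hN
  have hN0 : (N : ℂ) ≠ 0 := by exact_mod_cast (Nat.one_le_iff_ne_zero.mp hN1)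
  have hFan : ∀ z ∈ ball (0 : ℂ) 1, AnalyticAt ℂ F z := fun z hz ↦
    hF.analyticAt (isOpen_ball.mem_nhds hz)
  have hbr : closedBall (0 : ℂ) r ⊆ ball 0 1 := closedBall_subset_ball hr1
  have hsr : sphere (0 : ℂ) |r| ⊆ ball 0 1 := by
    rw [abs_of_pos hr]; exact sphere_subset_closedBall.trans hbr
  have hF1 : ∀ z ∈ ball (0 : ℂ) 1, F z ≠ 1 := fun z hz h1 ↦ hFN z hz (by rw [h1, one_pow])
  -- the two corollaries
  have hA := cor621 hN1 hr hr1 hF hF0 hFN hM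
  have hB := cor622 hr hr1 hF hF0 hF'0 hF' hF1 hM
  set f : ℂ → ℂ := fun w ↦ 1 - F w ^ N with hf
  have hfne : ∀ z ∈ ball (0 : ℂ) 1, f z ≠ 0 := fun z hz ↦ by
    simp only [hf]; exact sub_ne_zero.mpr (hFN z hz).symm
  have hFN1 : ∀ z ∈ ball (0 : ℂ) 1, F z ^ N - 1 ≠ 0 := fun z hz ↦ sub_ne_zero.mpr (hFN z hz)
  have hf' : ∀ z ∈ ball (0 : ℂ) 1, deriv f z = -(N * F z ^ (N - 1) * deriv F z) := by
    intro z hz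
    have h := ((hF.differentiableAt (isOpen_ball.mem_nhds hz)).hasDerivAt.pow N).const_sub 1
    simpa [hf] using h.deriv
  change circleAverage (fun z ↦ log⁺ ‖deriv f z / f z‖) 0 r ≤ _ at hA
  -- meromorphy on the circle
  have hmF : MeromorphicOn F (sphere (0 : ℂ) |r|) := fun z hz ↦ (hFan z (hsr hz)).meromorphicAt
  have hmP : MeromorphicOn (fun z ↦ F z ^ N / (F z ^ N - 1)) (sphere (0 : ℂ) |r|) := fun z hz ↦
    ((hFan z (hsr hz)).pow N).meromorphicAt.div (((hFan z (hsr hz)).pow N).sub analyticAt_const).meromorphicAt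
  have hm1 : MeromorphicOn (fun z ↦ F z / deriv F z) (sphere (0 : ℂ) |r|) := fun z hz ↦
    (hFan z (hsr hz)).meromorphicAt.div (hFan z (hsr hz)).deriv.meromorphicAt
  have hfan : ∀ z ∈ ball (0 : ℂ) 1, AnalyticAt ℂ f z := fun z hz ↦
    analyticAt_const.sub ((hFan z hz).pow N)
  have hm2 : MeromorphicOn (fun z ↦ deriv f z / f z) (sphere (0 : ℂ) |r|) := fun z hz ↦
    (hfan z (hsr hz)).deriv.meromorphicAt.div (hfan z (hsr hz)).meromorphicAt
  have hmFN : MeromorphicOn (fun z ↦ F z ^ N) (sphere (0 : ℂ) |r|) := fun z hz ↦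
    ((hFan z (hsr hz)).pow N).meromorphicAt
  have hmFN1 : MeromorphicOn (fun z ↦ F z ^ N - 1) (sphere (0 : ℂ) |r|) := fun z hz ↦
    (((hFan z (hsr hz)).pow N).sub analyticAt_const).meromorphicAt
  have hminv : MeromorphicOn (fun z ↦ (F z ^ N - 1)⁻¹) (sphere (0 : ℂ) |r|) := fun z hz ↦
    (((hFan z (hsr hz)).pow N).sub analyticAt_const).meromorphicAt.inv
  -- (C) `m(r, p ∘ F) ≤ m(r, F/F') + m(r, f'/f)` from the identity (6.9)
  have hC : circleAverage (fun z ↦ log⁺ ‖F z ^ N / (F z ^ N - 1)‖) 0 r ≤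
      circleAverage (fun z ↦ log⁺ ‖F z / deriv F z‖) 0 r +
        circleAverage (fun z ↦ log⁺ ‖deriv f z / f z‖) 0 r + 0 := by
    refine circleAverage_posLog_norm_le_add_add_const hmP hm1 hm2 fun z hz ↦ ?_
    have hzb := hsr hz
    have hF'z := hF' z hzb
    have hfz := hfne z hzb
    have hid : F z ^ N / (F z ^ N - 1) = (F z / (N * deriv F z)) * (deriv f z / f z) := by
      have hpow : F z ^ N = F z * F z ^ (N - 1) := by
        rw [← pow_succ', Nat.sub_add_cancel hN1]
      have hNF : (N : ℂ) * deriv F z ≠ 0 := mul_ne_zero hN0 hF'z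
      have hmul : F z * -(↑N * F z ^ (N - 1) * deriv F z) = -(F z ^ N) * (↑N * deriv F z) := by
        rw [hpow]; ring
      rw [hf' z hzb, show f z = 1 - F z ^ N from rfl, div_mul_div_comm, hmul,
        mul_comm ((N : ℂ) * deriv F z) (1 - F z ^ N), mul_div_mul_right _ _ hNF, neg_div,
        ← div_neg, neg_sub]
    rw [hid, norm_mul, add_zero]
    calc log⁺ (‖F z / (N * deriv F z)‖ * ‖deriv f z / f z‖)
        ≤ log⁺ ‖F z / (N * deriv F z)‖ + log⁺ ‖deriv f z / f z‖ := posLog_mul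
      _ ≤ log⁺ ‖F z / deriv F z‖ + log⁺ ‖deriv f z / f z‖ := by
          have hnorm : ‖F z / (N * deriv F z)‖ ≤ ‖F z / deriv F z‖ := by
            rw [norm_div, norm_div, norm_mul]
            refine div_le_div_of_nonneg_left (norm_nonneg _) (norm_pos_iff.mpr hF'z) ?_
            have : (1 : ℝ) ≤ ‖(N : ℂ)‖ := by
              rw [Complex.norm_natCast]; exact_mod_cast hN1
            nlinarith [norm_nonneg (deriv F z)]
          linarith [posLog_le_posLog (norm_nonneg _) hnorm]
  -- (D) the lower bound `N m(r, F) ≤ m(r, p ∘ F) + 2 log 2`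
  have hD1 : (N : ℝ) * circleAverage (fun z ↦ log⁺ ‖F z‖) 0 r ≤
      circleAverage (fun z ↦ log⁺ ‖F z ^ N - 1‖) 0 r + Real.log 2 := by
    rw [← circleAverage_posLog_norm_pow]
    refine circleAverage_posLog_norm_le_add_const hmFN hmFN1 fun z hz ↦ ?_
    have := posLog_norm_add_le (F z ^ N - 1) (1 : ℂ)
    simpa using this
  have hD2 : circleAverage (fun z ↦ log⁺ ‖F z ^ N - 1‖) 0 r =
      circleAverage (fun z ↦ log⁺ ‖(F z ^ N - 1)⁻¹‖) 0 r := by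
    rw [circleAverage_posLog_norm_inv hmFN1]
    have h0 : circleAverage (fun z ↦ Real.log ‖F z ^ N - 1‖) 0 r = 0 := by
      have h := AnalyticOnNhd.circleAverage_log_norm_of_ne_zero (c := 0) (R := r)
        (g := fun z ↦ F z ^ N - 1)
        (fun z hz ↦ ((hFan z (hbr (by simpa [abs_of_pos hr] using hz))).pow N).sub analyticAt_const)
        (fun z hz ↦ hFN1 z (hbr (by simpa [abs_of_pos hr] using hz)))
      rw [h, hF0, zero_pow (Nat.one_le_iff_ne_zero.mp hN1), zero_sub, norm_neg, norm_one,
        Real.log_one]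
    rw [h0, sub_zero]
  have hD3 : circleAverage (fun z ↦ log⁺ ‖(F z ^ N - 1)⁻¹‖) 0 r ≤
      circleAverage (fun z ↦ log⁺ ‖F z ^ N / (F z ^ N - 1)‖) 0 r + Real.log 2 := by
    refine circleAverage_posLog_norm_le_add_const hminv hmP fun z hz ↦ ?_
    have hne := hFN1 z (hsr hz)
    have hid : (F z ^ N - 1)⁻¹ = F z ^ N / (F z ^ N - 1) + (-1) := by
      field_simp
      ring
    rw [hid]
    have := posLog_norm_add_le (F z ^ N / (F z ^ N - 1)) (-1 : ℂ)
    simpa using this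
  -- assembly
  have hNm : (N : ℝ) * circleAverage (fun z ↦ log⁺ ‖F z‖) 0 r ≤
      circleAverage (fun z ↦ log⁺ ‖F z / deriv F z‖) 0 r +
        circleAverage (fun z ↦ log⁺ ‖deriv f z / f z‖) 0 r + 2 * Real.log 2 := by
    linarith [hD1, hD2, hD3, hC]
  nlinarith [hNm, hA, hB]

end Literature.Analysis.Complex
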